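import Mathlib
import Summits.Ventures.LatticeQCDFlow.TrivializingMaps.JacobianTransport

/-!
# LatticeQCDFlow / TrivializingMaps — weighted transport along the cut-off flow, for a general `C¹` rate

HONEST FRAMING: exact (Metropolis-corrected) sampling algorithms for lattice gauge theory; figures
of merit are autocorrelation/cost numbers at stated couplings and volumes; no continuum-physics claim.

Venture `LatticeQCDFlow` (cell pub-lqcd), topic `TrivializingMaps`, row 31 (lean-2).  `JacobianTransport.lean`
transports an observable along the cut-off ambient flow of a generator with the weight `exp ∫ d̃iv`, which
needs the divergence to be `C¹` (a `C²` generator).  To reach the `C¹` generators of Lüscher's statement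
(file A's `JacobianFormula`), the divergence is replaced here by an ARBITRARY `C¹` rate
`c : ℝ × M_n(ℂ)^E → ℝ` (later: a `C¹` uniform approximation of `div Z` on `[-T, T] × SU(n)^E`):

* `logJacW`, `transportFnW` — `Y_s(W) = ∫_s^{t₀} c(r, Ψ_{s→r} W) dr`, `U(s, W) = Õ(Ψ_{s→t₀} W) e^{Y_s(W)}`,
  jointly `C¹` in `(s, W)` for a `C¹` generator and a `C¹` rate;
* `fderiv_transportFnW_apply_one_cutField` — the weighted transport identity `DU[(1, X)] = -c · U`;

All elementary ([folklore]) given the tree's ODE library; assembled in `JacobianFormulaC1.lean`.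
-/

noncomputable section

open MeasureTheory Matrix Set Filter Function Metric intervalIntegral
open scoped Matrix Topology NNReal

namespace Summit.Ventures.LatticeQCDFlow.TrivializingMaps

open Literature.MathematicalPhysics.QuantumFieldTheory
open Literature.MathematicalPhysics.QuantumFieldTheory.Luscher2010
open Literature.MathematicalPhysics.QuantumFieldTheory.WilsonFlow
open Literature.Analysis.ODE
open scoped Matrix.Norms.Frobenius ContDiff

variable {d L n : ℕ} [NeZero L]

/-! ## The weighted transport for a general `C¹` rate `c` -/

section Transport

variable {Z : Generator d L n} (hZ1 : ContDiff ℝ 1 fun p : ℝ × AmbConfig d L n => Z p.1 p.2) (T : ℝ)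
  (c : ℝ × AmbConfig d L n → ℝ) (t₀ : ℝ)

/-- **The weighted log-Jacobian** along the cut-off flow for a rate `c`: `Y_s(W) = ∫_s^{t₀} c(r, Ψ_{s→r} W) dr`
(for `c = d̃iv` this is the exponent of eq. (3.9)). [cite: Luscher2010Trivializing, §3.2 eq. (3.9)] -/
def logJacW (s : ℝ) (W : AmbConfig d L n) : ℝ :=
  ∫ r in s..t₀, c (r, cutFlow hZ1 T s r W)

/-- The rate along the flow is continuous in `r`. [folklore] -/
theorem continuous_rate_cutFlow (hc : ContDiff ℝ 1 c) (s : ℝ) (W : AmbConfig d L n) :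
    Continuous fun r => c (r, cutFlow hZ1 T s r W) :=
  (hc).continuous.comp (continuous_id.prodMk
    ((contDiff_cutFlow hZ1 T).continuous.comp
      (continuous_const.prodMk (continuous_id.prodMk continuous_const))))

/-- The log-Jacobian after the affine substitution `r = s + ρ (t₀ - s)`: an integral over `[0, 1]` of a
jointly `C¹` integrand. [folklore] -/
theorem logJacW_eq_integral_unit (s : ℝ) (W : AmbConfig d L n) :
    logJacW hZ1 T c t₀ s W = ∫ ρ in (0 : ℝ)..1,
      (t₀ - s) * c ((t₀ - s) * ρ + s, cutFlow hZ1 T s ((t₀ - s) * ρ + s) W) := by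
  unfold logJacW
  have h := intervalIntegral.smul_integral_comp_mul_add
    (f := fun r => c (r, cutFlow hZ1 T s r W)) (a := 0) (b := 1) (t₀ - s) s
  rw [mul_zero, zero_add, mul_one, sub_add_cancel] at h
  rw [← h, ← intervalIntegral.integral_smul]
  rfl

/-- **The weighted log-Jacobian is jointly `C¹` in `(s, W)`** (for a `C¹` rate). [folklore] -/
theorem contDiff_logJacW (hc : ContDiff ℝ 1 c) :
    ContDiff ℝ 1 fun q : ℝ × AmbConfig d L n => logJacW hZ1 T c t₀ q.1 q.2 := by
  have heq : (fun q : ℝ × AmbConfig d L n => logJacW hZ1 T c t₀ q.1 q.2) = fun q => ∫ ρ in (0 : ℝ)..1,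
      (t₀ - q.1) * c ((t₀ - q.1) * ρ + q.1, cutFlow hZ1 T q.1 ((t₀ - q.1) * ρ + q.1) q.2) :=
    funext fun q => logJacW_eq_integral_unit hZ1 T c t₀ q.1 q.2
  rw [heq]
  -- the integrand `(ρ, (s, W)) ↦ (t₀ - s) d̃iv((t₀-s)ρ+s, Ψ_{s→(t₀-s)ρ+s} W)` is `C¹`
  have htime : ContDiff ℝ 1 fun y : ℝ × (ℝ × AmbConfig d L n) => (t₀ - y.2.1) * y.1 + y.2.1 :=
    ((contDiff_const.sub (contDiff_fst.comp contDiff_snd)).mul contDiff_fst).add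
      (contDiff_fst.comp contDiff_snd)
  have hflow : ContDiff ℝ 1 fun y : ℝ × (ℝ × AmbConfig d L n) =>
      cutFlow hZ1 T y.2.1 ((t₀ - y.2.1) * y.1 + y.2.1) y.2.2 :=
    (contDiff_cutFlow hZ1 T).comp ((contDiff_fst.comp contDiff_snd).prodMk
      (htime.prodMk (contDiff_snd.comp contDiff_snd)))
  have hH : ContDiff ℝ 1 fun y : ℝ × (ℝ × AmbConfig d L n) =>
      (t₀ - y.2.1) * c ((t₀ - y.2.1) * y.1 + y.2.1,
        cutFlow hZ1 T y.2.1 ((t₀ - y.2.1) * y.1 + y.2.1) y.2.2) :=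
    (contDiff_const.sub (contDiff_fst.comp contDiff_snd)).mul
      ((hc).comp (htime.prodMk hflow))
  exact contDiff_one_parametric_intervalIntegral hH 0 1

/-- **The weighted transported observable** `U(s, W) = Õ(Ψ_{s→t₀} W) · exp Y_s(W)`.
[cite: Luscher2010Trivializing, §3.2 eq. (3.9)] -/
def transportFnW (O : AmbConfig d L n → ℝ) (q : ℝ × AmbConfig d L n) : ℝ :=
  O (cutFlow hZ1 T q.1 t₀ q.2) * Real.exp (logJacW hZ1 T c t₀ q.1 q.2)

/-- The transported observable is jointly `C¹`. [folklore] -/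
theorem contDiff_transportFnW (hc : ContDiff ℝ 1 c)
    {O : AmbConfig d L n → ℝ} (hO : ContDiff ℝ 1 O) :
    ContDiff ℝ 1 (transportFnW hZ1 T c t₀ O) := by
  unfold transportFnW
  refine (hO.comp ?_).mul (Real.contDiff_exp.comp (contDiff_logJacW hZ1 T c t₀ hc))
  exact (contDiff_cutFlow hZ1 T).comp (contDiff_fst.prodMk (contDiff_const.prodMk contDiff_snd))

/-- At the target time the transported observable is the observable: `U(t₀, W) = Õ(W)`. [folklore] -/
theorem transportFnW_self (O : AmbConfig d L n → ℝ) (W : AmbConfig d L n) :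
    transportFnW hZ1 T c t₀ O (t₀, W) = O W := by
  simp [transportFnW, logJacW, cutFlow_self, intervalIntegral.integral_same]

/-- Along the flow line `σ ↦ (s + σ, Ψ_{s→s+σ} W)` the transported observable changes only through the
log-Jacobian: `U(s+σ, Ψ_{s→s+σ} W) = U(s, W) · exp(-∫_s^{s+σ} d̃iv(r, Ψ_{s→r} W) dr)`
(Chapman–Kolmogorov and additivity of the integral). [folklore] -/
theorem transportFnW_flowLine (hc : ContDiff ℝ 1 c)
    (O : AmbConfig d L n → ℝ) (s : ℝ) (W : AmbConfig d L n) (σ : ℝ) :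
    transportFnW hZ1 T c t₀ O (s + σ, cutFlow hZ1 T s (s + σ) W) =
      transportFnW hZ1 T c t₀ O (s, W) *
        Real.exp (-∫ r in s..s + σ, c (r, cutFlow hZ1 T s r W)) := by
  unfold transportFnW logJacW
  simp only [cutFlow_trans]
  have hint : ∀ a b, IntervalIntegrable (fun r => c (r, cutFlow hZ1 T s r W)) volume a b :=
    fun a b => (continuous_rate_cutFlow hZ1 T c hc s W).intervalIntegrable a b
  have hsplit : ∫ r in s + σ..t₀, c (r, cutFlow hZ1 T s r W) =
      (∫ r in s..t₀, c (r, cutFlow hZ1 T s r W)) -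
        ∫ r in s..s + σ, c (r, cutFlow hZ1 T s r W) := by
    rw [eq_sub_iff_add_eq, add_comm, intervalIntegral.integral_add_adjacent_intervals (hint _ _) (hint _ _)]
  rw [hsplit, sub_eq_add_neg, Real.exp_add, mul_assoc]

/-- **The weighted transport identity**: `DU(s, W)[(1, X_T(s, W))] = -c(s, W) · U(s, W)` at every `(s, W)`
(differentiate `transportFnW_flowLine` at `σ = 0`). [cite: Luscher2010Trivializing, §3.2 eqs. (3.4)–(3.9)] -/
theorem fderiv_transportFnW_apply_one_cutField (hc : ContDiff ℝ 1 c)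
    {O : AmbConfig d L n → ℝ} (hO : ContDiff ℝ 1 O)
    (s : ℝ) (W : AmbConfig d L n) :
    fderiv ℝ (transportFnW hZ1 T c t₀ O) (s, W) ((1 : ℝ), cutField Z T (s, W)) =
      -c (s, W) * transportFnW hZ1 T c t₀ O (s, W) := by
  -- the flow line through `(s, W)` in `ℝ × M_n(ℂ)^E` and its velocity at `σ = 0`
  have hq : HasDerivAt (fun σ : ℝ => ((s + σ, cutFlow hZ1 T s (s + σ) W) : ℝ × AmbConfig d L n))
      ((1 : ℝ), cutField Z T (s, W)) 0 := by
    have h1 : HasDerivAt (fun σ : ℝ => s + σ) 1 0 := by simpa using (hasDerivAt_id (0 : ℝ)).const_add s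
    have h2 : HasDerivAt (fun σ : ℝ => cutFlow hZ1 T s (s + σ) W)
        (cutField Z T (s + 0, cutFlow hZ1 T s (s + 0) W)) 0 := by
      have h := hasDerivAt_cutFlow hZ1 T s W (s + 0)
      exact h.comp_const_add s 0
    rw [add_zero, cutFlow_self] at h2
    exact h1.prodMk h2
  -- left-hand side: chain rule
  have hL : HasDerivAt (fun σ : ℝ => transportFnW hZ1 T c t₀ O (s + σ, cutFlow hZ1 T s (s + σ) W))
      (fderiv ℝ (transportFnW hZ1 T c t₀ O) (s, W) ((1 : ℝ), cutField Z T (s, W))) 0 := by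
    have hd : HasFDerivAt (transportFnW hZ1 T c t₀ O) (fderiv ℝ (transportFnW hZ1 T c t₀ O) (s, W))
        (s + 0, cutFlow hZ1 T s (s + 0) W) := by
      rw [add_zero, cutFlow_self]
      exact ((contDiff_transportFnW hZ1 T c t₀ hc hO).differentiable one_ne_zero _).hasFDerivAt
    exact hd.comp_hasDerivAt (0 : ℝ) hq
  -- right-hand side: fundamental theorem of calculus at the upper limit
  have hk := continuous_rate_cutFlow hZ1 T c hc s W
  have hR : HasDerivAt (fun σ : ℝ => transportFnW hZ1 T c t₀ O (s, W) *
      Real.exp (-∫ r in s..s + σ, c (r, cutFlow hZ1 T s r W)))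
      (transportFnW hZ1 T c t₀ O (s, W) *
        (Real.exp (-∫ r in s..s + 0, c (r, cutFlow hZ1 T s r W)) *
          -c (s + 0, cutFlow hZ1 T s (s + 0) W))) 0 := by
    have hI : HasDerivAt (fun u : ℝ => ∫ r in s..u, c (r, cutFlow hZ1 T s r W))
        (c (s + 0, cutFlow hZ1 T s (s + 0) W)) (s + 0) :=
      intervalIntegral.integral_hasDerivAt_right (hk.intervalIntegrable _ _)
        (hk.stronglyMeasurableAtFilter _ _) hk.continuousAt
    have hI' := (hI.comp_const_add s 0).neg.exp
    exact hI'.const_mul _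
  rw [add_zero, cutFlow_self, intervalIntegral.integral_same, neg_zero, Real.exp_zero, one_mul] at hR
  have heq : (fun σ : ℝ => transportFnW hZ1 T c t₀ O (s + σ, cutFlow hZ1 T s (s + σ) W)) =
      fun σ => transportFnW hZ1 T c t₀ O (s, W) *
        Real.exp (-∫ r in s..s + σ, c (r, cutFlow hZ1 T s r W)) :=
    funext fun σ => transportFnW_flowLine hZ1 T c t₀ hc O s W σ
  rw [heq] at hL
  have := hL.unique hR
  rw [this]
  ring

end Transport

end Summit.Ventures.LatticeQCDFlow.TrivializingMaps

end
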